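import Summits.BirchSwinnertonDyer.Rank1Residual.X11b.Three.RouteR1LowerFromDivisibility
import Summits.BirchSwinnertonDyer.Rank1Residual.GaloisImage.PropagatedConditionCardEP
import HarnessLib

/-!
# X11b at `p = 3`, route R1 — the `≥`-half from the one-sided shape (2.4)♭@3, WITHOUT the cited
# Euler–Poincaré binder `hEP` (cell `b2b-bsdres`, team `x11b3`; T-EPC touch of seat p6's FILE B, filed by seat p9)

HONEST FRAMING (cell `b2b-bsdres`, run/shared/lean/b2b/bsd-rank1-residual/, verbatim in every
file): the goal of the cell is to DELETE the COMBINATION-SHAPED residual classes of the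
Birch–Swinnerton-Dyer formula for ALL analytic-rank `≤ 1` elliptic curves over `ℚ` — "full BSD
formula for every rank `≤ 1` curve in class `C`" assembled STRICTLY from published theorems — so
that the rank-`≤ 1` remainder becomes exactly the CONSTRUCTION-SHAPED classes, which are TYPED
(missing-input `Prop`s), NOT attempted. This is not "finishing BSD". Team `x11b3` (N8/O2: X11b at
`p = 3`); a RESEARCH ROUTE; no claim beyond the stated class; X11 ∧ `r = 1` at `p = 3` stays
CONSTRUCTION-SHAPED / O2 OPEN; nothing here books anything or changes a label. Theorems only (no
definition, no named fact, no `sorry`); FILE B (`Three/RouteR1LowerFromDivisibility.lean`, x11b3-p6,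
p298791) is IMPORTED and left byte-untouched; its OPEN shape `Three.IMCDivIntFrameAtErratumData₃`
stays an attribute-free hypothesis-packaging `Prop` (lead R12-2: no `@[conjecture]`, no `_holds`).

## Why

FILE B's five consumers carry, next to the cited Poitou–Tate binder `hPT`, the cited binder
`hEP : ∀ K v, localEulerPoincareCharacteristic (v.adicCompletion K)` = Tate's local Euler–Poincaré
characteristic formula (Milne *ADT* I Thm. 2.8), a named fact of the tree. Team n1011 (row T-EPC,
seat p04) has now PROVED that named fact for every non-archimedean local field of characteristic `0`:
`Literature.NumberTheory.GaloisRepresentations.localEulerPoincareCharacteristic_holds`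
(`GaloisImage/LocalEulerPoincareCharacteristicHolds.lean`, p300487; `GaloisImage/EPCTateFormula.lean`,
p300886) and INSTANTIATED it at `v.adicCompletion K` (the tree's instance
`instIsNonarchimedeanLocalFieldAdicCompletion`, `CharZero` from the injective `algebraMap K K_v`):
`GaloisImage.EP.localEulerPoincareCharacteristic_adicCompletion` (`GaloisImage/PropagatedConditionCardEP.lean`,
seat p04 GEN 9) — which is FILE B's binder `hEP` at `(K, v)` on the nose. So the five consumers are
re-issued here WITHOUT `hEP`, that theorem consumed BY NAME (lead GEN 11 rulings R12-20 / R12-21: one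
new S sibling, FILE B being 399 lines; every other binder and every conclusion VERBATIM; `hPT` stays
cited; nothing of n1011's restated).

## What this file proves (namespace `Summit.BirchSwinnertonDyer.Rank1Residual.X11b.Three.OfEPC`)

* `OfEPC.imcLowerWaldspurgerOnTreeAt_three_of_imcDivIntFrameAtErratumData₃` (§2 of FILE B),
  `OfEPC.display53LowerAt_three_of_imcDivIntFrameAtErratumData₃` (§3),
  `OfEPC.R1.missingLowerBoundAt_three_of_imcDivIntFrameAtErratumData₃`,
  `OfEPC.R1.bsdp_three_of_imcDivIntFrameAtErratumData₃_of_not_dvd_tamagawaProduct`,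
  `OfEPC.R1.bsdp_three_of_imcDivIntFrameAtErratumData₃_at` (§4) — FILE B's theorems of the same
  names with the binder `hEP` REMOVED and nothing else changed (each is FILE B's theorem fed with
  n1011's `GaloisImage.EP.localEulerPoincareCharacteristic_adicCompletion`).

READING OF RECORD (lead GEN 11, R12-20, pre-stated): one cited input fewer on the R1@3 display;
nothing discharged on the residual map; the OPEN shape (2.4)♭@3 (`hD`) and the cited `hPT` remain;
node `Three.HsiehDescentAt₃` / v4.3 / v4.5 / counts UNCHANGED; nothing booked.

References: [MilneADT2006] I Thm. 2.8 (now a tree theorem), I Thm. 4.10(b) (cited, `hPT`);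
[Castella2018] §5; [Castella2018Erratum] (2.4); [JetchevSkinnerWan2017] §7.4.1; FILE B's list.
-/

noncomputable section

open scoped Classical

open WeierstrassCurve NumberField IsDedekindDomain Field PowerSeries
open Literature.NumberTheory.EllipticCurves Literature.NumberTheory.EllipticCurves.GreenbergSelmer
  Literature.NumberTheory.EllipticCurves.ModularForms Literature.NumberTheory.EllipticCurves.Rank1Residual
  Literature.NumberTheory.EllipticCurves.Rank1Residual.Typed Literature.NumberTheory.EllipticCurves.Castella2018
  Literature.NumberTheory.GaloisRepresentations Literature.NumberTheory.GaloisCohomology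
open Summit.BirchSwinnertonDyer.Rank1Residual.X11b.AcSelmer Summit.BirchSwinnertonDyer.Rank1Residual.X11b.Halves

namespace Summit.BirchSwinnertonDyer.Rank1Residual.X11b.Three.OfEPC

/-! ### §2′ Route p2's pointwise open input at an R1@3 erratum datum — without `hEP` -/

section Pointwise

variable {W : WeierstrassCurve ℚ} [W.IsElliptic] [W.IsGloballyMinimal]
  {K : Type} [Field K] [NumberField K]

/-- **FILE B §2 without `hEP`**: route p2's POINTWISE open input `(IMC≥∘BDP)ᵗ` at an R1@3 erratum
datum — `IMCLowerWaldspurgerOnTreeAt 3 κ 𝔭 γ (embAt K 3 𝔭) P` — from the one-sided shape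
`Three.IMCDivIntFrameAtErratumData₃ W` (OPEN at `3`), GZK, modularity and the cited Poitou–Tate sum
formula `hPT`; Tate's Euler–Poincaré formula is now SUPPLIED (n1011's
`GaloisImage.EP.localEulerPoincareCharacteristic_adicCompletion`). Every other binder and the
conclusion are FILE B's, token for token. CONDITIONAL on the shape;
discharges nothing on the residual map; nothing booked.
[cite: Castella2018, Thms. 2.3, 3.1, 3.2 and §5 (arXiv:1704.06608 pp. 5, 9, 12)] [cite: Castella2018Erratum, (2.4) (p. 4)]
[cite: MilneADT2006, Ch. I, Thm. 4.10(b) (cited) and Thm. 2.8 (proved in the tree)] -/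
theorem imcLowerWaldspurgerOnTreeAt_three_of_imcDivIntFrameAtErratumData₃
    (hGZK : rank_eq_analyticRank_of_analyticRank_le_one) (hnf : exists_isNewformOf)
    (hPT : ∀ (K : Type) [Field K] [NumberField K], poitouTate_sum_localTatePairing_eq_zero K)
    (ι : PadicAlgCl 3 ≃+* ℂ) (hD : IMCDivIntFrameAtErratumData₃ W)
    [NeZero (W.conductorNorm ℤ)] {q : ℕ} [Fact q.Prime]
    (Dt : ModularParametrizationData W (W.conductorNorm ℤ))
    (H : HeegnerDatum (W.conductorNorm ℤ) (NumberField.discr K)) (ιK : K →+* ℂ)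
    {P : (W.baseChange K).toAffine.Point} (hX : IsX11Three W) (hloc : X11.AprimeLocusAt W 3)
    (hq3 : q ≠ 3) (hmq : Mult W q) (hns : ¬ W.HasSplitMultiplicativeReductionAtPrime q)
    (hvq : ¬ 3 ∣ padicValInt q W.minimalDiscriminantInt) (hK : IsErratumField W K q)
    (hCas : Cas20Standing K 3 (W.conductorNorm ℤ / 3))
    (hP : WeierstrassCurve.Affine.Point.map ιK.toRatAlgHom P = heegnerPointComplex Dt H)
    (hc : ¬ (3 : ℤ) ∣ Dt.c) (hinf : ¬ IsOfFinAddOrder P)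
    {κ : ZpExtension K 3} (hκ : κ.IsAnticyclotomic) (γ : Field.absoluteGaloisGroup K)
    [Fact (κ.IsTopGenerator γ)]
    (𝔭 : HeightOneSpectrum (𝓞 K)) (h𝔭 : ((3 : ℕ) : 𝓞 K) ∈ 𝔭.asIdeal)
    (he : 𝔭.asIdeal.ramificationIdx (𝓞 ℚ) = 1) (hf : 𝔭.asIdeal.inertiaDeg (𝓞 ℚ) = 1) :
    IMCLowerWaldspurgerOnTreeAt 3 κ 𝔭 γ (embAt K 3 𝔭 h𝔭 he hf) P :=
  Three.imcLowerWaldspurgerOnTreeAt_three_of_imcDivIntFrameAtErratumData₃ hGZK hnf hPT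
    (fun K _ _ v ↦ GaloisImage.EP.localEulerPoincareCharacteristic_adicCompletion K v)
    ι hD Dt H ιK hX hloc hq3 hmq hns hvq hK hCas hP hc hinf hκ γ 𝔭 h𝔭 he hf

/-! ### §3′ The `≥`-half (A≥|VoR)@3 at an R1@3 erratum datum — without `hEP` -/

/-- **FILE B §3 without `hEP`**: the `≥`-HALF of Castella's display (5.3) at `3` —
(A≥|VoR)@3 = `Display53LowerAt W 3 K P` — at an R1@3 erratum datum, from the one-sided shape
`Three.IMCDivIntFrameAtErratumData₃ W` (OPEN at `3`), GZK, modularity and the cited `hPT`; Tate's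
Euler–Poincaré formula SUPPLIED. Binders and conclusion otherwise FILE B's, token for token.
CONDITIONAL on the shape; one open input moved one level down, NOT removed; nothing booked.
[cite: Castella2018, §5 (5.1)–(5.3) (arXiv:1704.06608 p. 12)]
[cite: JetchevSkinnerWan2017, §7.4.1 (eq:shalowerK-1) (arXiv:1512.06894 p. 30)] -/
theorem display53LowerAt_three_of_imcDivIntFrameAtErratumData₃
    (hGZK : rank_eq_analyticRank_of_analyticRank_le_one) (hnf : exists_isNewformOf)
    (hPT : ∀ (K : Type) [Field K] [NumberField K], poitouTate_sum_localTatePairing_eq_zero K)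
    (hD : IMCDivIntFrameAtErratumData₃ W)
    [NeZero (W.conductorNorm ℤ)] {q : ℕ} [Fact q.Prime]
    (Dt : ModularParametrizationData W (W.conductorNorm ℤ))
    (H : HeegnerDatum (W.conductorNorm ℤ) (NumberField.discr K)) (ιK : K →+* ℂ)
    {P : (W.baseChange K).toAffine.Point} (hX : IsX11Three W) (hloc : X11.AprimeLocusAt W 3)
    (hq3 : q ≠ 3) (hmq : Mult W q) (hns : ¬ W.HasSplitMultiplicativeReductionAtPrime q)
    (hvq : ¬ 3 ∣ padicValInt q W.minimalDiscriminantInt) (hK : IsErratumField W K q)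
    (hCas : Cas20Standing K 3 (W.conductorNorm ℤ / 3))
    (hP : WeierstrassCurve.Affine.Point.map ιK.toRatAlgHom P = heegnerPointComplex Dt H)
    (hc : ¬ (3 : ℤ) ∣ Dt.c) (hinf : ¬ IsOfFinAddOrder P) :
    Display53LowerAt W 3 K P :=
  Three.display53LowerAt_three_of_imcDivIntFrameAtErratumData₃ hGZK hnf hPT
    (fun K _ _ v ↦ GaloisImage.EP.localEulerPoincareCharacteristic_adicCompletion K v)
    hD Dt H ιK hX hloc hq3 hmq hns hvq hK hCas hP hc hinf

end Pointwise

/-! ### §4′ Route R1's `p = 3` end forms from the shape — without `hEP` -/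

section EndForms

/-- **FILE B §4, first end form, without `hEP`**: the main-conjecture half of `BSD(E,3)` on route
R1@3's population — `Typed.MissingLowerBoundAt W 3` — from SEVEN published named facts (`hGZ` GZ86
I.7.3, `hGZK`, `hSk` Skinner 2016 Thm. C, `hnf`, `hCST` CST14 Thm. 1.1, `hMaz`, `hNS`), the cited
`hPT` (Milne ADT I.4.10) and the ONE OPEN class-level input `hD : ∀ W, Three.IMCDivIntFrameAtErratumData₃ W`
(NOT a cited fact; no announcement at `3`); Tate's Euler–Poincaré formula (formerly `hEP`) is
SUPPLIED by the tree. CONDITIONAL on `hD`; deletes nothing; X11 ∧ `r = 1` at `3` stays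
CONSTRUCTION-SHAPED; nothing booked.
[cite: Castella2018, §5 (arXiv:1704.06608 p. 12)] [cite: JetchevSkinnerWan2017, §7.4.1 (eq:shalowerK-1)]
[cite: Castella2018Erratum, (2.4) and Thm. A′ (pp. 1, 4) with "p > 3" read as "p = 3" (shape only; nothing asserted)] -/
theorem R1.missingLowerBoundAt_three_of_imcDivIntFrameAtErratumData₃
    (hGZ : GrossZagier1986_thm_I_7_3) (hGZK : rank_eq_analyticRank_of_analyticRank_le_one)
    (hSk : Skinner2016.thmC_padicValRat_bsd_rank_zero) (hnf : exists_isNewformOf)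
    (hCST : CaiShuTian2014.thm11_trivialChar)
    (hMaz : mazur_not_dvd_maninConstant_of_odd) (hNS : integral_neronScaling_of_isGloballyMinimal)
    (hPT : ∀ (K : Type) [Field K] [NumberField K], poitouTate_sum_localTatePairing_eq_zero K)
    (hD : ∀ (W : WeierstrassCurve ℚ) [W.IsElliptic] [W.IsGloballyMinimal],
      IMCDivIntFrameAtErratumData₃ W)
    (W : WeierstrassCurve ℚ) [W.IsElliptic] [W.IsGloballyMinimal]
    (hX : IsX11Three W) (hloc : X11.AprimeRam2LocusAt W 3)
    (q : ℕ) [Fact q.Prime] (hq2 : q ≠ 2) (hq3 : q ≠ 3) (hmq : Mult W q)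
    (hnsq : ¬ W.HasSplitMultiplicativeReductionAtPrime q)
    (hvq : ¬ 3 ∣ padicValInt q W.minimalDiscriminantInt)
    (K : Type) [Field K] [NumberField K] (hKf : IsErratumField W K q) :
    Typed.MissingLowerBoundAt W 3 :=
  Three.R1.missingLowerBoundAt_three_of_imcDivIntFrameAtErratumData₃ hGZ hGZK hSk hnf hCST hMaz hNS
    hPT (fun K _ _ v ↦ GaloisImage.EP.localEulerPoincareCharacteristic_adicCompletion K v)
    hD W hX hloc q hq2 hq3 hmq hnsq hvq K hKf

/-- **FILE B §4, second end form, without `hEP`**: `BSD(E,3)` on route R1@3's population ∩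
{`3 ∤ ∏_ℓ c_ℓ(E)`} from (2.4)♭@3 — UPPER half = multr1-p2's Kolyvagin theorem at a classical
Heegner field (`hGZ hKo hB hSk hGZK hmod hnf hHL hMaz hNS`), LOWER half = route R1 at `3`
(`hGZ1 hCST hFH` + the above) fed by §3′ (+ the cited `hPT`; Tate's Euler–Poincaré formula SUPPLIED
by the tree). So on R1@3's population ∩ A1 the kernel asks of the literature — beyond PUBLISHED
theorems and the cited PT sum formula — EXACTLY the one-sided shape (2.4)♭@3 at the erratum data.
CONDITIONAL on `hD` (OPEN at `3`); deletes nothing; X11 ∧ `r = 1` at `3` stays CONSTRUCTION-SHAPED;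
nothing booked.
[cite: McCallumLMS1991, §1 Theorem (Kolyvagin), p. 296] [cite: Castella2018, §5 (arXiv:1704.06608 p. 12)]
[cite: JetchevSkinnerWan2017, §7.4.1 (eq:shalowerK-1)] [cite: Miller2011LMS, Def. 1.1] -/
theorem R1.bsdp_three_of_imcDivIntFrameAtErratumData₃_of_not_dvd_tamagawaProduct
    (hGZ : ∀ (N : ℕ) [NeZero N] (W : WeierstrassCurve ℚ) (K : Type) [Field K] [NumberField K],
      gross_zagier N W K)
    (hKo : ∀ (N : ℕ) [NeZero N] (W : WeierstrassCurve ℚ) (K : Type) [Field K] [NumberField K],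
      kolyvagin N W K)
    (hB : ∀ (N : ℕ) [NeZero N] (W : WeierstrassCurve ℚ) (K : Type) [Field K] [NumberField K],
      Kolyvagin1990_padicValNat_card_sha_le N W K)
    (hSk : Skinner2016.thmC_padicValRat_bsd_rank_zero)
    (hGZK : rank_eq_analyticRank_of_analyticRank_le_one) (hmod : hasEntireLFunction_rat)
    (hnf : exists_isNewformOf) (hHL : HoffsteinLuo1997_exists_twist_L_one_ne_zero)
    (hMaz : mazur_not_dvd_maninConstant_of_odd) (hNS : integral_neronScaling_of_isGloballyMinimal)
    (hGZ1 : GrossZagier1986_thm_I_7_3) (hCST : CaiShuTian2014.thm11_trivialChar)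
    (hFH : friedbergHoffstein_exists_twist_ne_zero_ramifiedAt)
    (hPT : ∀ (K : Type) [Field K] [NumberField K], poitouTate_sum_localTatePairing_eq_zero K)
    (hD : ∀ (W : WeierstrassCurve ℚ) [W.IsElliptic] [W.IsGloballyMinimal],
      IMCDivIntFrameAtErratumData₃ W)
    (W : WeierstrassCurve ℚ) [W.IsElliptic] [W.IsGloballyMinimal]
    (hX : IsX11Three W) (hloc : X11.AprimeRam2LocusAt W 3)
    (hq : ∃ (q : ℕ) (_ : Fact q.Prime), q ≠ 2 ∧ q ≠ 3 ∧ Mult W q ∧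
      ¬ W.HasSplitMultiplicativeReductionAtPrime q ∧ ¬ 3 ∣ padicValInt q W.minimalDiscriminantInt)
    (htam : ¬ 3 ∣ W.tamagawaProduct) : BSDp W 3 :=
  Three.R1.bsdp_three_of_imcDivIntFrameAtErratumData₃_of_not_dvd_tamagawaProduct hGZ hKo hB hSk hGZK
    hmod hnf hHL hMaz hNS hGZ1 hCST hFH hPT
    (fun K _ _ v ↦ GaloisImage.EP.localEulerPoincareCharacteristic_adicCompletion K v)
    hD W hX hloc hq htam

/-- **FILE B §4, third end form, without `hEP`**: `BSD(E,3)` for ONE curve at ONE R1@3 datum with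
`3 ∤ ∏_ℓ c_ℓ(E)`, from the one-sided shape for THIS curve (`hD : Three.IMCDivIntFrameAtErratumData₃ W`)
— S8♭ with its per-datum input supplied by §3′. TEN published named-fact binders + the cited `hPT`
+ the OPEN shape for this `W`; Tate's Euler–Poincaré formula SUPPLIED by the tree; discharges
nothing; nothing booked.
[cite: Castella2018, §5 (arXiv:1704.06608 p. 12)] [cite: JetchevSkinnerWan2017, §7.4.1 (eq:shalowerK-1)]
[cite: McCallumLMS1991, §1 Theorem (Kolyvagin), p. 296] [cite: Miller2011LMS, Def. 1.1] -/
theorem R1.bsdp_three_of_imcDivIntFrameAtErratumData₃_at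
    (hGZ : ∀ (N : ℕ) [NeZero N] (W : WeierstrassCurve ℚ) (K : Type) [Field K] [NumberField K],
      gross_zagier N W K)
    (hKo : ∀ (N : ℕ) [NeZero N] (W : WeierstrassCurve ℚ) (K : Type) [Field K] [NumberField K],
      kolyvagin N W K)
    (hB : ∀ (N : ℕ) [NeZero N] (W : WeierstrassCurve ℚ) (K : Type) [Field K] [NumberField K],
      Kolyvagin1990_padicValNat_card_sha_le N W K)
    (hSk : Skinner2016.thmC_padicValRat_bsd_rank_zero)
    (hGZK : rank_eq_analyticRank_of_analyticRank_le_one) (hnf : exists_isNewformOf)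
    (hHL : HoffsteinLuo1997_exists_twist_L_one_ne_zero) (hMaz : mazur_not_dvd_maninConstant_of_odd)
    (hGZ1 : GrossZagier1986_thm_I_7_3) (hCST : CaiShuTian2014.thm11_trivialChar)
    (hPT : ∀ (K : Type) [Field K] [NumberField K], poitouTate_sum_localTatePairing_eq_zero K)
    (W : WeierstrassCurve ℚ) [W.IsElliptic] [W.IsGloballyMinimal] [NeZero (W.conductorNorm ℤ)]
    (hD : IMCDivIntFrameAtErratumData₃ W)
    (hX : IsX11Three W) (hloc : X11.AprimeRam2LocusAt W 3)
    (q : ℕ) [Fact q.Prime] (hq2 : q ≠ 2) (hq3 : q ≠ 3) (hmq : Mult W q)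
    (hnsq : ¬ W.HasSplitMultiplicativeReductionAtPrime q)
    (hvq : ¬ 3 ∣ padicValInt q W.minimalDiscriminantInt)
    (K : Type) [Field K] [NumberField K] (hKf : IsErratumField W K q)
    (Dt : ModularParametrizationData W (W.conductorNorm ℤ))
    (H : HeegnerDatum (W.conductorNorm ℤ) (NumberField.discr K)) (ι : K →+* ℂ)
    (P : (W.baseChange K).toAffine.Point)
    (hP : WeierstrassCurve.Affine.Point.map ι.toRatAlgHom P = heegnerPointComplex Dt H)
    (hc : ¬ (3 : ℤ) ∣ Dt.c) (hnt : ¬ IsOfFinAddOrder P) (htam : ¬ 3 ∣ W.tamagawaProduct) :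
    BSDp W 3 :=
  Three.R1.bsdp_three_of_imcDivIntFrameAtErratumData₃_at hGZ hKo hB hSk hGZK hnf hHL hMaz hGZ1 hCST
    hPT (fun K _ _ v ↦ GaloisImage.EP.localEulerPoincareCharacteristic_adicCompletion K v)
    W hD hX hloc q hq2 hq3 hmq hnsq hvq K hKf Dt H ι P hP hc hnt htam

end EndForms

end Summit.BirchSwinnertonDyer.Rank1Residual.X11b.Three.OfEPC

end
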